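import Summits.ResolutionOfSingularities.ResolutionOfSingularities.Theorems.PurelyInseparableDim4ResConeCInfSecondTschirnhausPrime
import Summits.ResolutionOfSingularities.ResolutionOfSingularities.Theorems.PurelyInseparableDim4ResConeCInfSecondTschirnhausFramePrime
import HarnessLib
import HarnessLib.Audit.Tags

/-!
# Purely inseparable four-folds — THE SECOND TSCHIRNHAUS OF THE FLAGLESS BRANCH («W8♯», FILE ♯6 of res-dim4-p-3 g6's FLAGLESS♯ port plan):
# killing the `x_f`-free `ū^{d−3}`-row of a regime-R residual with the ♯-FLAG `g = coeff_{x_λ²x_μ²u^{d−2}} G ≠ 0` as pivot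
# (cell `res-dim4-pi`, K2(p) lane, rung-1 POWER-CONE LINE «light pair of TAIL(p, p−1, 3) ∀ p», flagless branch; seat res-dim4-typ-1 g6)

[OURS · counted 0 · cell `res-dim4-pi` · K2(p) lane (holder res-dim4-p-12 g5, ruling g5-23 «reshape the flag» = res-dim4-p-3 g6's MEMO
FLAGLESS♯ `res-dim4-p-3/MEMO-g6-FLAGLESS-SHARP.md`, §3 (TSCH♯) and §6 ♯6, bus 2026-08-29 13:55Z / 14:11Z).]  Nothing here proves K2(p)
for any `p`, any TAIL(p, p−1, 3), FLAGLESS♯, `NoIsolatedTrap p p` or resolution of singularities in dimension ≥ 4 / characteristic `p` —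
NOT proved.  AI kernel work, weaker than expert review.  An EXISTENCE lemma for a coordinate change of OUR frame; it ASSUMES the ♯-flag
`g ≠ 0` (at `d = 6` supplied by isolation in regime R per the memo's (U♯); for general `d` the witness position is `d`-specific —
res-dim4-eng-w4 QFLAG-2♯, bus 14:05Z — and stays a hypothesis here).

THE READING THAT MAKES THIS FILE THIN (bus 14:11Z).  In `F`-exponents the ♯-frame of the memo is the ROW edition of W8
(`exists_second_tschirnhaus_row_prime`, p714919) with ROW `(eu, ef) := (d − 3, 0)` and the flag MOVED one step up the pair ledger:
from `x_λx_μ·u^{d−2}` (dead by straightness) to the ♯-flag `x_λ²x_μ²·u^{d−2}`.  So W8's `x_f`-free existence theorem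
`exists_second_tschirnhaus_prime` APPLIED TO `G₁ := G.divMonomial (x_λx_μ)` with `eu := d − 3` is the ♯-Tschirnhaus:
* INPUT: the ledger♯ READ-OFF on the `x_f`-free rows below degree `M + 2` («`coeff_n G = 0` for `n_f = 0`, `|n| < M + 2`,
  `n_λ ≤ 1 ∨ n_μ ≤ 1`» — regime R of the memo: residual exponents `a, b ≥ 2`), the ♯-FLAG `coeff_{x_λ²x_μ²u^{d−2}} G ≠ 0`, the LAYER
  ENTRY `coeff_{x_λ²x_μ²u^{d−3}} G = 0` (a monomial of residual degree `d + 1` with contact exponent `0 ≤ d − 2`: dead by (LAYER)), and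
  `((d − 2 : ℕ) : K) ≠ 0` (the pivot `C(d−2, d−3) = d − 2`; `d − 2 < p`), `M ≥ d + 1`, `d ≥ 3`.
* OUTPUT (**`exists_second_tschirnhaus_sharp_prime`**, §2): for every `N` a `ψ ∈ K[x_λ, x_μ]` (`ψ(0) = 0`, `u, f ∉ vars ψ`) such that
  `τ := FrameChange.tsch u ψ` (i) kills THE WHOLE `x_f`-FREE `ū^{d−3}`-ROW in jet form: `coeff_m (τ G) = 0` for `m_u = d − 3`,
  `m_f = 0`, `|m| ≤ N + d + 1`, `|m| < M + 2` — stronger than «the cross `X♯ = {(a,2,d−3,0)} ∪ {(2,b,d−3,0)}` is dead» and what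
  Weierstrass–Tschirnhaus gives anyway (memo (MC)); (ii) keeps the ♯-flag; (iii) keeps the ledger♯ read-off.
* §1 **`coeff_tsch_eq_pairDiv_of_sharpLedger`** is the transfer: under the ledger♯ read-off every `x_f`-free coefficient of `τ G` below
  degree `M + 2` is the shifted coefficient of `τ G₁` (`G = x_λx_μ·G₁ + R`, `τ` fixes `x_λx_μ`, and a monomial of `τ R` below the bound
  would come — `exists_of_mem_support_tsch` — from an `x_f`-free monomial of `R` of no larger degree with `λ`- or `μ`-exponent `0`: dead).
* §3 **`tsch_contact_le_of_degree_le`** — the generic transport «below degree `D` every monomial has contact exponent `≥ c`» through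
  `τ` (degrees are not lowered, `x_f`-exponents are kept); with `D = d + 3`, `c = d − 1` this is «order `d + 2` ∧ straight ∧ LAYER» of
  the memo, kept by the move.  The exact ledger / ledger♯ in support form are kept by W8b `tsch_pairLedger_le` (`e = 2, k = d − 1` /
  `e = 3, k = d − 2`), the dead row's support dress is W8b `row_support_of_coeff` with `(eu, ef) = (d − 3, 0)` — no new lemma.
[cite: Abhyankar1990, Lecture 25 pp. 216–217 and Lecture 26 pp. 228–229] [cite: CossartPiltant2009, I.8.3.6]
bears_on: LADDER-RESOLUTION:D157-DOOR2 (res-dim4-pi · K2(p) · power cones · flagless branch ♯6 second Tschirnhaus).  Supports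
stmt-ResolutionOfSingularities-16155 (helper).
-/

set_option linter.dupNamespace false -- mandated namespace of this single-conjunct summit

noncomputable section

namespace Summit.ResolutionOfSingularities.ResolutionOfSingularities.Theorems.PIDim4

namespace ResCone

open MvPolynomial Finset FrameChange
open Literature.AlgebraicGeometry.Resolution

variable {K : Type} [Field K]

/-! ## 1. Reading `τ G` through `G / x_λx_μ` under the ledger♯ read-off -/

/-- **Reading `tsch u ψ G` through `G₁ := G.divMonomial (x_λx_μ)`**: if every `x_f`-free monomial of `G` below degree `B` with
`λ`-exponent `≤ 1` or `μ`-exponent `≤ 1` is dead (the ledger♯ read-off), then for `x_f`-free `n`, `|n| < B`: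
`coeff_n (τ G) = coeff_{n − x_λx_μ} (τ G₁)` if `x_λx_μ ∣ x^n`, else `0` (`ψ(0) = 0`, `f ∉ vars ψ`, `u ≠ λ, μ, f`). [OURS] [folklore] -/
theorem coeff_tsch_eq_pairDiv_of_sharpLedger {lam mu u f : Fin 4} (hlm : lam ≠ mu) (hul : u ≠ lam) (hum : u ≠ mu) (hfu : f ≠ u)
    {ψ : MvPolynomial (Fin 4) K} (hψ0 : constantCoeff ψ = 0) (hψf : f ∉ ψ.vars) {G : MvPolynomial (Fin 4) K} {B : ℕ}
    (hled : ∀ n : Fin 4 →₀ ℕ, n f = 0 → n.degree < B → (n lam ≤ 1 ∨ n mu ≤ 1) → coeff n G = 0)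
    {n : Fin 4 →₀ ℕ} (hnf : n f = 0) (hnB : n.degree < B) :
    coeff n (tsch u ψ G) =
      if Finsupp.single lam 1 + Finsupp.single mu 1 ≤ n then
        coeff (n - (Finsupp.single lam 1 + Finsupp.single mu 1))
          (tsch u ψ (G.divMonomial (Finsupp.single lam 1 + Finsupp.single mu 1)))
      else 0 := by
  classical
  set s : Fin 4 →₀ ℕ := Finsupp.single lam 1 + Finsupp.single mu 1 with hs
  have hsplit := G.divMonomial_add_modMonomial s
  have hXs : tsch u ψ (monomial s (1 : K)) = monomial s 1 := by
    have : (monomial s (1 : K) : MvPolynomial (Fin 4) K) = X lam * X mu := by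
      rw [hs, X, X, monomial_mul, one_mul]
    rw [this, map_mul, tsch_X_of_ne ψ hul.symm, tsch_X_of_ne ψ hum.symm]
  -- the remainder contributes nothing to `x_f`-free coefficients below `B`
  have hR : coeff n (tsch u ψ (G.modMonomial s)) = 0 := by
    by_contra hne
    obtain ⟨β, hβ, hβf, hβdeg, hβle⟩ := exists_of_mem_support_tsch hfu.symm hψ0 hψf (G.modMonomial s) (mem_support_iff.mpr hne)
    have hnot : ¬ s ≤ β := fun hle => (mem_support_iff.mp hβ) (coeff_modMonomial_of_le _ hle)
    have hβG : coeff β G ≠ 0 := by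
      have h := mem_support_iff.mp hβ
      rwa [coeff_modMonomial_of_not_le _ hnot] at h
    have hor : β lam ≤ 1 ∨ β mu ≤ 1 := by
      rw [hs, pair_le_iff hlm] at hnot
      omega
    exact hβG (hled β (by rw [← hβf, hnf]) (lt_of_le_of_lt hβdeg hnB) hor)
  conv_lhs => rw [← hsplit, map_add, map_mul, hXs, coeff_add, coeff_monomial_mul', hR, add_zero]
  split_ifs with hle
  · rw [one_mul]
  · rfl

/-! ## 2. Existence of the ♯-Tschirnhaus -/

/-- **EXISTENCE OF THE SECOND TSCHIRNHAUS OF THE FLAGLESS BRANCH (W8♯).**  Fixed distinct letters `λ, μ, u, f`; `G` with the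
ledger♯ read-off on the `x_f`-free rows below degree `M + 2` (`n_λ ≤ 1 ∨ n_μ ≤ 1 ⇒ coeff_n G = 0`), the ♯-flag
`coeff_{x_λ²x_μ²u^{d−2}} G ≠ 0`, the LAYER entry `coeff_{x_λ²x_μ²u^{d−3}} G = 0`, `((d − 2 : ℕ) : K) ≠ 0`, `3 ≤ d`, `d + 1 ≤ M`.  Then for
every `N` there is `ψ` with `ψ(0) = 0`, `u, f ∉ vars ψ` such that `τ := tsch u ψ` (i) kills the whole `x_f`-free `ū^{d−3}`-row in jet
form: `coeff_m (τ G) = 0` for `m_u = d − 3`, `m_f = 0`, `|m| ≤ N + d + 1`, `|m| < M + 2`; (ii) keeps the ♯-flag; (iii) keeps the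
ledger♯ read-off below degree `M + 2`.  (W8 `exists_second_tschirnhaus_prime` on `G.divMonomial (x_λx_μ)` with `eu := d − 3`, read
back through §1.) [OURS] [cite: Abhyankar1990, Lecture 25 pp. 216–217 and Lecture 26 pp. 228–229] [cite: CossartPiltant2009, I.8.3.6] -/
theorem exists_second_tschirnhaus_sharp_prime {lam mu u f : Fin 4} (hlm : lam ≠ mu) (hul : u ≠ lam) (hum : u ≠ mu) (hfl : f ≠ lam)
    (hfm : f ≠ mu) (hfu : f ≠ u) {G : MvPolynomial (Fin 4) K} {M d : ℕ} (hd3 : 3 ≤ d) (hdK : ((d - 2 : ℕ) : K) ≠ 0)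
    (hM : d + 1 ≤ M)
    (hled : ∀ n : Fin 4 →₀ ℕ, n f = 0 → n.degree < M + 2 → (n lam ≤ 1 ∨ n mu ≤ 1) → coeff n G = 0)
    (hg : coeff (Finsupp.single lam 2 + Finsupp.single mu 2 + Finsupp.single u (d - 2)) G ≠ 0)
    (hlayer : coeff (Finsupp.single lam 2 + Finsupp.single mu 2 + Finsupp.single u (d - 3)) G = 0) (N : ℕ) :
    ∃ ψ : MvPolynomial (Fin 4) K, constantCoeff ψ = 0 ∧ u ∉ ψ.vars ∧ f ∉ ψ.vars ∧
      (∀ a ∈ ψ.support, a u = 0 ∧ a f = 0 ∧ 1 ≤ a.degree) ∧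
      (∀ m : Fin 4 →₀ ℕ, m u = d - 3 → m f = 0 → m.degree ≤ N + d + 1 → m.degree < M + 2 →
        coeff m (tsch u ψ G) = 0) ∧
      coeff (Finsupp.single lam 2 + Finsupp.single mu 2 + Finsupp.single u (d - 2)) (tsch u ψ G) =
        coeff (Finsupp.single lam 2 + Finsupp.single mu 2 + Finsupp.single u (d - 2)) G ∧
      (∀ n : Fin 4 →₀ ℕ, n f = 0 → n.degree < M + 2 → (n lam ≤ 1 ∨ n mu ≤ 1) → coeff n (tsch u ψ G) = 0) := by
  classical
  set s : Fin 4 →₀ ℕ := Finsupp.single lam 1 + Finsupp.single mu 1 with hs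
  set G₁ := G.divMonomial s with hG₁
  have hsu : s u = 0 := by rw [hs, pair_apply_of_ne hul hum]
  have hsf : s f = 0 := by rw [hs, pair_apply_of_ne hfl hfm]
  have hsl : s lam = 1 := by rw [hs, Finsupp.add_apply, Finsupp.single_eq_same, Finsupp.single_eq_of_ne hlm, add_zero]
  have hsm : s mu = 1 := by rw [hs, Finsupp.add_apply, Finsupp.single_eq_of_ne hlm.symm, Finsupp.single_eq_same, zero_add]
  have hsdeg : s.degree = 2 := by rw [hs, map_add, Finsupp.degree_single, Finsupp.degree_single]
  -- the ♯-monomials are the W8 monomials shifted by `s`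
  have hshift : ∀ k : ℕ, (Finsupp.single lam 2 + Finsupp.single mu 2 + Finsupp.single u k : Fin 4 →₀ ℕ) =
      s + (Finsupp.single lam 1 + Finsupp.single mu 1 + Finsupp.single u k) := fun k => by
    rw [hs, show (Finsupp.single lam 2 : Fin 4 →₀ ℕ) = Finsupp.single lam 1 + Finsupp.single lam 1 by
      rw [← Finsupp.single_add], show (Finsupp.single mu 2 : Fin 4 →₀ ℕ) = Finsupp.single mu 1 + Finsupp.single mu 1 by
      rw [← Finsupp.single_add]]
    abel
  have hd32 : d - 3 + 1 = d - 2 := by omega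
  -- W8's inputs on `G₁`
  have hled₁ : ∀ n : Fin 4 →₀ ℕ, n f = 0 → n.degree < M → (n lam = 0 ∨ n mu = 0) → coeff n G₁ = 0 := by
    intro n hnf hnM hor
    rw [hG₁, coeff_divMonomial]
    refine hled (s + n) (by rw [Finsupp.add_apply, hsf, hnf]) (by rw [map_add, hsdeg]; omega) ?_
    rcases hor with h | h
    · left; rw [Finsupp.add_apply, hsl, h]
    · right; rw [Finsupp.add_apply, hsm, h]
  have hV₁ : coeff (Finsupp.single lam 1 + Finsupp.single mu 1 + Finsupp.single u (d - 3 + 1)) G₁ ≠ 0 := by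
    rw [hG₁, coeff_divMonomial, ← hshift, hd32]; exact hg
  have h2₁ : coeff (Finsupp.single lam 1 + Finsupp.single mu 1 + Finsupp.single u (d - 3)) G₁ = 0 := by
    rw [hG₁, coeff_divMonomial, ← hshift]; exact hlayer
  have heK : ((d - 3 + 1 : ℕ) : K) ≠ 0 := by rw [hd32]; exact hdK
  obtain ⟨ψ, hψ0, hψu, hψf, hψs, hrow₁, hflag₁, hled₁'⟩ :=
    exists_second_tschirnhaus_prime hlm hul hum hfl hfm hfu (G := G₁) (M := M) (eu := d - 3) heK (by omega) hled₁ hV₁ h2₁ N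
  have hread := fun (n : Fin 4 →₀ ℕ) (hnf : n f = 0) (hnB : n.degree < M + 2) =>
    coeff_tsch_eq_pairDiv_of_sharpLedger hlm hul hum hfu hψ0 hψf hled hnf hnB
  refine ⟨ψ, hψ0, hψu, hψf, hψs, fun m hmu hmf hmN hmM => ?_, ?_, fun n hnf hnM hn => ?_⟩
  · -- (i) the whole `x_f`-free `ū^{d−3}`-row
    rw [hread m hmf hmM]
    split_ifs with hle
    · have hdeg : (m - s).degree + 2 = m.degree := by
        have := congrArg Finsupp.degree (tsub_add_cancel_of_le hle)
        rw [map_add, hsdeg] at this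
        omega
      exact hrow₁ (m - s) (by rw [Finsupp.tsub_apply, hsu, hmu, Nat.sub_zero]) (by rw [Finsupp.tsub_apply, hsf, hmf])
        (by omega) (by omega)
    · rfl
  · -- (ii) the ♯-flag is kept
    have hf0 : (Finsupp.single lam 2 + Finsupp.single mu 2 + Finsupp.single u (d - 2) : Fin 4 →₀ ℕ) f = 0 := by
      rw [hshift, Finsupp.add_apply, hsf, Finsupp.add_apply, pair_apply_of_ne hfl hfm, Finsupp.single_eq_of_ne hfu, add_zero]
    have hdeg : (Finsupp.single lam 2 + Finsupp.single mu 2 + Finsupp.single u (d - 2) : Fin 4 →₀ ℕ).degree < M + 2 := by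
      rw [map_add, map_add, Finsupp.degree_single, Finsupp.degree_single, Finsupp.degree_single]; omega
    rw [hread _ hf0 hdeg, hshift, if_pos le_self_add, add_tsub_cancel_left, ← hd32, hflag₁, hG₁, coeff_divMonomial]
  · -- (iii) the ledger♯ read-off is kept
    rw [hread n hnf hnM]
    split_ifs with hle
    · have hdeg : (n - s).degree + 2 = n.degree := by
        have := congrArg Finsupp.degree (tsub_add_cancel_of_le hle)
        rw [map_add, hsdeg] at this
        omega
      have hle' := hle
      rw [pair_le_iff hlm] at hle'
      refine hled₁' (n - s) (by rw [Finsupp.tsub_apply, hsf, hnf]) (by omega) ?_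
      rcases hn with h | h
      · left; rw [Finsupp.tsub_apply, hsl]; omega
      · right; rw [Finsupp.tsub_apply, hsm]; omega
    · rfl

/-! ## 3. «Order, straightness and LAYER» are kept: contact exponents below a degree -/

/-- **Below degree `D` every monomial keeps contact exponent `≥ c` through the move**: if every monomial of `P` of degree `≤ D` has
`x_f`-exponent `≥ c`, so does every monomial of `tsch u ψ P` (`ψ(0) = 0`, `f ∉ vars ψ`: degrees are not lowered, `x_f`-exponents are
kept).  With `D = d + 3`, `c = d − 1` this is the conjunction «order `d + 2`, straight (`x_λx_μx_f^d` only in degree `d + 2`), LAYER (no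
degree-`(d + 3)` monomial of contact exponent `≤ d − 2`)» of the flagless ♯-frame. [OURS] [folklore] -/
theorem tsch_contact_le_of_degree_le {u f : Fin 4} (huf : u ≠ f) {ψ : MvPolynomial (Fin 4) K} (hψ0 : constantCoeff ψ = 0)
    (hψf : f ∉ ψ.vars) {P : MvPolynomial (Fin 4) K} {D c : ℕ} (hP : ∀ β ∈ P.support, β.degree ≤ D → c ≤ β f)
    {γ : Fin 4 →₀ ℕ} (hγ : γ ∈ (tsch u ψ P).support) (hγD : γ.degree ≤ D) : c ≤ γ f := by
  obtain ⟨β, hβ, hβf, hβdeg, -⟩ := exists_of_mem_support_tsch huf hψ0 hψf P hγ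
  rw [hβf]
  exact hP β hβ (hβdeg.trans hγD)

/-- The same in the LAYER dress of res-dim4-p-3 g6's ♯2 (`…CInfLayerStepPrime`): «`coeff_E = 0` for `|E| = d + 3`, `E_f + 2 ≤ d`» passes
through the move, given that `P` has no monomial of degree `≤ d + 3` with `x_f`-exponent `≤ d − 2` other than in degree `d + 3`
(order `d + 2` and straightness supply this). [OURS] [folklore] -/
theorem tsch_layer_prime {u f : Fin 4} (huf : u ≠ f) {ψ : MvPolynomial (Fin 4) K} (hψ0 : constantCoeff ψ = 0)
    (hψf : f ∉ ψ.vars) {P : MvPolynomial (Fin 4) K} {d : ℕ}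
    (hlow : ∀ β ∈ P.support, β.degree ≤ d + 2 → d - 1 ≤ β f)
    (hlayer : ∀ E : Fin 4 →₀ ℕ, E.degree = d + 3 → E f + 2 ≤ d → coeff E P = 0) :
    ∀ E : Fin 4 →₀ ℕ, E.degree = d + 3 → E f + 2 ≤ d → coeff E (tsch u ψ P) = 0 := by
  intro E hEdeg hEf
  by_contra hne
  have h := tsch_contact_le_of_degree_le huf hψ0 hψf (P := P) (D := d + 3) (c := d - 1) (fun β hβ hβD => ?_)
    (mem_support_iff.mpr hne) hEdeg.le
  · omega
  · rcases Nat.lt_or_ge β.degree (d + 3) with hlt | hge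
    · exact hlow β hβ (by omega)
    · by_contra hc
      exact (mem_support_iff.mp hβ) (hlayer β (le_antisymm hβD hge) (by omega))

/-! ## 4. The ROW edition: the ♯-flag of the `x_f^c`-row (appended; holder g5-26 «the flag position by value») -/

/-- **EXISTENCE OF THE ♯-TSCHIRNHAUS FOR THE ROW `x_f^c`** (§2 applied to `G.divMonomial (c·e_f)`, read back through W8's
`coeff_tsch_eq_coeff_tsch_divMonomial`: the move acts row by row in `x_f`).  INPUT: the ledger♯ read-off on the `x_f^c`-row below degree
`M + 2 + c` («`coeff_n G = 0` for `n_f = c`, `|n| < M + 2 + c`, `n_λ ≤ 1 ∨ n_μ ≤ 1`»), the row's ♯-FLAG `coeff_{x_λ²x_μ²u^{d−2−c}f^c} G ≠ 0`, the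
LAYER entry `coeff_{x_λ²x_μ²u^{d−3−c}f^c} G = 0`, `((d − c − 2 : ℕ) : K) ≠ 0`, `c + 3 ≤ d`, `d − c + 1 ≤ M`.  OUTPUT: for every `N` a
`ψ ∈ K[x_λ, x_μ]` such that `τ := tsch u ψ` (i) kills the whole `(u, f)`-bidegree `(d − 3 − c, c)` in jet form (`|m| ≤ N + d − c + 1 + c`,
`|m| < M + 2 + c`); (ii) keeps the row's ♯-flag; (iii) keeps the row's ledger♯ read-off.  The `c = 0` instance is §2. [OURS]
[cite: Abhyankar1990, Lecture 25 pp. 216–217 and Lecture 26 pp. 228–229] [cite: CossartPiltant2009, I.8.3.6] -/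
theorem exists_second_tschirnhaus_sharp_row_prime {lam mu u f : Fin 4} (hlm : lam ≠ mu) (hul : u ≠ lam) (hum : u ≠ mu)
    (hfl : f ≠ lam) (hfm : f ≠ mu) (hfu : f ≠ u) {G : MvPolynomial (Fin 4) K} {M d c : ℕ} (hcd : c + 3 ≤ d)
    (hdK : ((d - c - 2 : ℕ) : K) ≠ 0) (hM : d - c + 1 ≤ M)
    (hled : ∀ n : Fin 4 →₀ ℕ, n f = c → n.degree < M + 2 + c → (n lam ≤ 1 ∨ n mu ≤ 1) → coeff n G = 0)
    (hg : coeff (Finsupp.single lam 2 + Finsupp.single mu 2 + Finsupp.single u (d - 2 - c) + Finsupp.single f c) G ≠ 0)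
    (hlayer : coeff (Finsupp.single lam 2 + Finsupp.single mu 2 + Finsupp.single u (d - 3 - c) + Finsupp.single f c) G = 0) (N : ℕ) :
    ∃ ψ : MvPolynomial (Fin 4) K, constantCoeff ψ = 0 ∧ u ∉ ψ.vars ∧ f ∉ ψ.vars ∧
      (∀ a ∈ ψ.support, a u = 0 ∧ a f = 0 ∧ 1 ≤ a.degree) ∧
      (∀ m : Fin 4 →₀ ℕ, m u = d - 3 - c → m f = c → m.degree ≤ N + (d - c) + 1 + c → m.degree < M + 2 + c →
        coeff m (tsch u ψ G) = 0) ∧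
      coeff (Finsupp.single lam 2 + Finsupp.single mu 2 + Finsupp.single u (d - 2 - c) + Finsupp.single f c) (tsch u ψ G) =
        coeff (Finsupp.single lam 2 + Finsupp.single mu 2 + Finsupp.single u (d - 2 - c) + Finsupp.single f c) G ∧
      (∀ n : Fin 4 →₀ ℕ, n f = c → n.degree < M + 2 + c → (n lam ≤ 1 ∨ n mu ≤ 1) → coeff n (tsch u ψ G) = 0) := by
  classical
  set G' := G.divMonomial (Finsupp.single f c) with hG'
  -- exponents of `x_f`-degree `c` are `c·e_f + (x_f-free)`
  have hdec : ∀ n : Fin 4 →₀ ℕ, n f = c → n = Finsupp.single f c + (n - Finsupp.single f c) ∧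
      (n - Finsupp.single f c) f = 0 ∧ (n - Finsupp.single f c).degree + c = n.degree ∧
      (n - Finsupp.single f c) lam = n lam ∧ (n - Finsupp.single f c) mu = n mu ∧ (n - Finsupp.single f c) u = n u := by
    intro n hnf
    have hle : Finsupp.single f c ≤ n := by
      intro i
      by_cases hi : i = f
      · subst hi; rw [Finsupp.single_eq_same, hnf]
      · rw [Finsupp.single_eq_of_ne hi]; exact Nat.zero_le _
    have heq : n = Finsupp.single f c + (n - Finsupp.single f c) := (add_tsub_cancel_of_le hle).symm
    refine ⟨heq, by rw [Finsupp.tsub_apply, Finsupp.single_eq_same, hnf, Nat.sub_self], ?_,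
      by rw [Finsupp.tsub_apply, Finsupp.single_eq_of_ne hfl.symm, Nat.sub_zero],
      by rw [Finsupp.tsub_apply, Finsupp.single_eq_of_ne hfm.symm, Nat.sub_zero],
      by rw [Finsupp.tsub_apply, Finsupp.single_eq_of_ne hfu.symm, Nat.sub_zero]⟩
    have := congrArg Finsupp.degree heq
    rw [map_add, Finsupp.degree_single] at this
    omega
  -- the `x_f`-free shifts of the two ♯-monomials
  have hshift : ∀ k : ℕ, (Finsupp.single lam 2 + Finsupp.single mu 2 + Finsupp.single u k + Finsupp.single f c : Fin 4 →₀ ℕ) =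
      Finsupp.single f c + (Finsupp.single lam 2 + Finsupp.single mu 2 + Finsupp.single u k) := fun k => by abel
  have hcoeff' : ∀ m : Fin 4 →₀ ℕ, coeff m G' = coeff (Finsupp.single f c + m) G := fun m => by rw [hG', coeff_divMonomial]
  -- §2's inputs on `G'` with `d ↦ d − c`
  have hled' : ∀ n : Fin 4 →₀ ℕ, n f = 0 → n.degree < M + 2 → (n lam ≤ 1 ∨ n mu ≤ 1) → coeff n G' = 0 := by
    intro n hnf hnM hor
    rw [hcoeff']
    refine hled _ (by rw [Finsupp.add_apply, Finsupp.single_eq_same, hnf, add_zero]) (by rw [map_add, Finsupp.degree_single]; omega) ?_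
    rwa [Finsupp.add_apply, Finsupp.add_apply, Finsupp.single_eq_of_ne hfl.symm, Finsupp.single_eq_of_ne hfm.symm, zero_add, zero_add]
  have hg' : coeff (Finsupp.single lam 2 + Finsupp.single mu 2 + Finsupp.single u (d - c - 2)) G' ≠ 0 := by
    rw [hcoeff', ← hshift, show d - c - 2 = d - 2 - c by omega]; exact hg
  have hlayer' : coeff (Finsupp.single lam 2 + Finsupp.single mu 2 + Finsupp.single u (d - c - 3)) G' = 0 := by
    rw [hcoeff', ← hshift, show d - c - 3 = d - 3 - c by omega]; exact hlayer
  obtain ⟨ψ, hψ0, hψu, hψf, hψs, hrow', hflag', hledτ'⟩ :=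
    exists_second_tschirnhaus_sharp_prime hlm hul hum hfl hfm hfu (G := G') (M := M) (d := d - c) (by omega) hdK (by omega) hled' hg'
      hlayer' N
  have hread := fun (n : Fin 4 →₀ ℕ) (hnf : n f = c) => coeff_tsch_eq_coeff_tsch_divMonomial hfu.symm hψf c G hnf
  refine ⟨ψ, hψ0, hψu, hψf, hψs, fun m hmu hmf hmN hmM => ?_, ?_, fun n hnf hnM hn => ?_⟩
  · obtain ⟨-, hf0, hdeg, -, -, hu⟩ := hdec m hmf
    rw [hread m hmf]
    exact hrow' _ (by rw [hu, hmu]; omega) hf0 (by omega) (by omega)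
  · have hcf : (Finsupp.single lam 2 + Finsupp.single mu 2 + Finsupp.single u (d - 2 - c) + Finsupp.single f c : Fin 4 →₀ ℕ) f = c := by
      rw [Finsupp.add_apply, Finsupp.add_apply, Finsupp.add_apply, Finsupp.single_eq_of_ne hfl, Finsupp.single_eq_of_ne hfm,
        Finsupp.single_eq_of_ne hfu, Finsupp.single_eq_same, zero_add, zero_add, zero_add]
    rw [hread _ hcf, hshift, add_tsub_cancel_left, show d - 2 - c = d - c - 2 by omega, hflag', hcoeff']
  · obtain ⟨-, hf0, hdeg, hl, hm, -⟩ := hdec n hnf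
    rw [hread n hnf]
    exact hledτ' _ hf0 (by omega) (by rw [hl, hm]; exact hn)

end ResCone

end Summit.ResolutionOfSingularities.ResolutionOfSingularities.Theorems.PIDim4

end
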